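import Mathlib
import Summits.RiemannHypothesis.RiemannHypothesis.Theorems.SoloBlindLaguerreDepth
import Literature.Analysis.SpecialFunctions.InvSinSqPartialFractions

/-!
# The Laguerre-axis depth threshold, lattice form

`SoloBlindLaguerreDepth` proves the elementary inequality behind the threshold
`b ≥ (√6/π)·s`, stated with the closed form `(π/s)²/sin²(πt/s)`.  Here the classical
partial-fraction expansion `Σ_{n∈ℤ} (x+n)⁻² = π²/sin²(πx)`
(`Literature.Analysis.SpecialFunctions.hasSum_inv_sub_sq_add_inv_add_sq`) turns it into the
statement about the punctured lattice itself: for the model function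
`f_b(t) = (t² + b²)·∏_{k≠0} (1 − t/(ks)) e^{t/(ks)}` (a conjugate pair `±ib` planted among the
real zeros `sℤ ∖ {0}`), the logarithmic-derivative form of the Laguerre inequality
`L₁(f_b) = f_b'² − f_b f_b'' ≥ 0`, namely

`2(b² − t²)/(t² + b²)² ≤ Σ_{k≠0} 1/(t − ks)²   (t ∉ sℤ)`,

holds for every `t ∉ sℤ` if and only if `b ≥ (√6/π)·s`
(`soloBlind_laguerreLattice_iff`).  In words: the first Laguerre inequality of a function with
lattice-like real zeros of spacing `s` is blind to a planted pair of depth `b ≥ 0.7797·s` and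
detects every shallower one.

Main statements:
* `soloBlind_hasSum_lattice` — `Σ_{n≥0} (1/(t−(n+1)s)² + 1/(t+(n+1)s)²) = (π/s)²/sin²(πt/s) − 1/t²`
  for `t ∉ sℤ`, `0 < s` (scaled form of the Literature expansion);
* `soloBlind_laguerreLattice` — the inequality for `b ≥ (√6/π)s`;
* `soloBlind_laguerreLattice_sharp` — an explicit violation for every `0 < b < (√6/π)s`;
* `soloBlind_laguerreLattice_iff` — the threshold as a biconditional.
-/

noncomputable section

open Real

namespace Summit.RiemannHypothesis.RiemannHypothesis.Theorems

/-- If `t ∉ sℤ` (`0 < s`) then `sin(πt/s) ≠ 0`. -/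
theorem soloBlind_sin_lattice_ne_zero {s t : ℝ} (hs : 0 < s) (ht : ∀ n : ℤ, t ≠ n * s) :
    Real.sin (Real.pi * t / s) ≠ 0 := by
  intro h0
  obtain ⟨n, hn⟩ := Real.sin_eq_zero_iff.mp h0
  rw [eq_div_iff hs.ne'] at hn
  have h3 : Real.pi * t = Real.pi * (n * s) := by linear_combination (-1 : ℝ) * hn
  exact ht n (mul_left_cancel₀ Real.pi_ne_zero h3)

/-- If `sin(πt/s) ≠ 0` then `t ∉ sℤ`. -/
theorem soloBlind_lattice_of_sin_ne_zero {s t : ℝ} (hs : 0 < s)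
    (ht : Real.sin (Real.pi * t / s) ≠ 0) : ∀ n : ℤ, t ≠ n * s := by
  intro n h
  apply ht
  rw [h]
  have : Real.pi * (n * s) / s = n * Real.pi := by
    field_simp
  rw [this]
  exact_mod_cast Real.sin_int_mul_pi n

/-- **The punctured-lattice sum**, scaled: for `0 < s` and `t ∉ sℤ`,
`Σ_{n≥0} (1/(t−(n+1)s)² + 1/(t+(n+1)s)²) = (π/s)²/sin²(πt/s) − 1/t²`. -/
theorem soloBlind_hasSum_lattice (s t : ℝ) (hs : 0 < s) (ht : ∀ n : ℤ, t ≠ n * s) :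
    HasSum (fun n : ℕ => 1 / (t - (n + 1) * s) ^ 2 + 1 / (t + (n + 1) * s) ^ 2)
      ((Real.pi / s) ^ 2 / Real.sin (Real.pi * t / s) ^ 2 - 1 / t ^ 2) := by
  have hs' : s ≠ 0 := hs.ne'
  have hx : ∀ n : ℤ, t / s ≠ n := by
    intro n h
    rw [div_eq_iff hs'] at h
    exact ht n h
  have hsin : Real.sin (Real.pi * (t / s)) ≠ 0 := by
    rw [← mul_div_assoc]
    exact soloBlind_sin_lattice_ne_zero hs ht
  have ht0 : t ≠ 0 := by
    have := ht 0
    simpa using this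
  have h := (Literature.Analysis.SpecialFunctions.hasSum_inv_sub_sq_add_inv_add_sq hx).mul_left
    (1 / s ^ 2)
  have key1 : (fun n : ℕ => 1 / (t - (n + 1) * s) ^ 2 + 1 / (t + (n + 1) * s) ^ 2) =
      fun n : ℕ => 1 / s ^ 2 * (1 / (t / s - (n + 1)) ^ 2 + 1 / (t / s + (n + 1)) ^ 2) := by
    funext n
    have h1 : t - (n + 1) * s ≠ 0 := by
      have := ht (n + 1)
      push_cast at this
      exact sub_ne_zero.mpr this
    have h2 : t + (n + 1) * s ≠ 0 := by
      have := ht (-(n + 1))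
      push_cast at this
      intro h0
      apply this
      linarith
    have e1 : t / s - (n + 1) = (t - (n + 1) * s) / s := by
      field_simp
    have e2 : t / s + (n + 1) = (t + (n + 1) * s) / s := by
      field_simp
    rw [e1, e2, div_pow, div_pow]
    field_simp
  have key2 : (Real.pi / s) ^ 2 / Real.sin (Real.pi * t / s) ^ 2 - 1 / t ^ 2 =
      1 / s ^ 2 * (Real.pi ^ 2 / Real.sin (Real.pi * (t / s)) ^ 2 - 1 / (t / s) ^ 2) := by
    rw [mul_div_assoc]
    field_simp
  rw [key1, key2]
  exact h

/-- **Laguerre blindness below depth `(√6/π)s`, lattice form.**  For `0 < s`,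
`b ≥ (√6/π)·s` and every `t ∉ sℤ`:
`2(b² − t²)/(t² + b²)² ≤ Σ_{n≥0} (1/(t−(n+1)s)² + 1/(t+(n+1)s)²)`, i.e.
`(log f_b)'' ≤ 0` for the pair `±ib` planted in the punctured lattice `sℤ ∖ {0}`. -/
theorem soloBlind_laguerreLattice (s b t : ℝ) (hs : 0 < s) (hb : Real.sqrt 6 / Real.pi * s ≤ b)
    (ht : ∀ n : ℤ, t ≠ n * s) :
    2 * (b ^ 2 - t ^ 2) / (t ^ 2 + b ^ 2) ^ 2 ≤
      ∑' n : ℕ, (1 / (t - (n + 1) * s) ^ 2 + 1 / (t + (n + 1) * s) ^ 2) := by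
  rw [(soloBlind_hasSum_lattice s t hs ht).tsum_eq]
  have h := soloBlind_laguerreDepth s b t hs hb (soloBlind_sin_lattice_ne_zero hs ht)
  linarith

/-- **Sharpness, lattice form.**  For `0 < s` and every `0 < b < (√6/π)·s` there is `t ∉ sℤ`
with `Σ_{n≥0} (1/(t−(n+1)s)² + 1/(t+(n+1)s)²) < 2(b² − t²)/(t² + b²)²`, i.e. `L₁(f_b)(t) < 0`. -/
theorem soloBlind_laguerreLattice_sharp (s b : ℝ) (hs : 0 < s) (hb0 : 0 < b)
    (hb : b < Real.sqrt 6 / Real.pi * s) :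
    ∃ t : ℝ, (∀ n : ℤ, t ≠ n * s) ∧
      ∑' n : ℕ, (1 / (t - (n + 1) * s) ^ 2 + 1 / (t + (n + 1) * s) ^ 2) <
        2 * (b ^ 2 - t ^ 2) / (t ^ 2 + b ^ 2) ^ 2 := by
  obtain ⟨t, ht, hlt⟩ := soloBlind_laguerreDepth_sharp s b hs hb0 hb
  have ht' := soloBlind_lattice_of_sin_ne_zero hs ht
  refine ⟨t, ht', ?_⟩
  rw [(soloBlind_hasSum_lattice s t hs ht').tsum_eq]
  linarith

/-- **The threshold.**  For `0 < s` and `0 < b`: the lattice Laguerre inequality holds at every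
`t ∉ sℤ` if and only if `b ≥ (√6/π)·s = 0.7797·s`. -/
theorem soloBlind_laguerreLattice_iff (s b : ℝ) (hs : 0 < s) (hb0 : 0 < b) :
    (∀ t : ℝ, (∀ n : ℤ, t ≠ n * s) →
        2 * (b ^ 2 - t ^ 2) / (t ^ 2 + b ^ 2) ^ 2 ≤
          ∑' n : ℕ, (1 / (t - (n + 1) * s) ^ 2 + 1 / (t + (n + 1) * s) ^ 2)) ↔
      Real.sqrt 6 / Real.pi * s ≤ b := by
  constructor
  · intro h
    by_contra hlt
    push Not at hlt
    obtain ⟨t, ht, hl⟩ := soloBlind_laguerreLattice_sharp s b hs hb0 hlt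
    exact absurd (h t ht) (not_le.mpr hl)
  · intro hb t ht
    exact soloBlind_laguerreLattice s b t hs hb ht

end Summit.RiemannHypothesis.RiemannHypothesis.Theorems

end
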